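import Summits.AtomisticToContinuum.HydrodynamicLimit.Theorems.StiffCollisionalRelaxationAprioriBoundsEquilibriumStatics
import HarnessLib

/-!
# The open stub `partOneFixed` at homogeneous data: the fixed-time L¹ law of large numbers, every flow

Supporting file of the line `Sketch` for the crux `AprioriBounds` (stmt-AtomisticToContinuum-14827), lead prover
`prover-line-stmt-AtomisticToContinuum-14827-c1-0`.  The registered OPEN stub `stub_partOneFixed` (reshape r4) asks,
under the crux prefix, for a fixed-time L¹ law of large numbers of the empirical exponential moment along the flow:
`λ > 0`, `C₁`, a measurable profile `g` with `|g| ≤ C₁` on `[0,t]` and a rate `δ_N → 0` with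
`E_{P_N}|(N+1)⁻¹∑ᵢ e^{λ|vᵢ(s)|²} − g(s)| ≤ δ_N` for all `N` and all `s ≤ t`.  This file PROVES that stub VERBATIM at
the homogeneous profiles `(a₀, θ₀, u₀) = (1, θ₀, 0)` (`partOneFixed_homogeneous`), for EVERY family of hard-sphere
flows, with the explicit witnesses `λ = 1/(8θ₀)`, `g ≡ m = E_{N(0,θ₀)}e^{λ|v|²}`, `C₁ = |m|`,
`δ_N = (1 + Var/4)·(N+1)^{-1/2}` — the crux prefix (classical solution, `t = 0` LLN, chamber) is then idle
(`σ₀ = 1/2`, `η₁ = 1`).  Docking demonstration: chained by the landed `stub_partOneChain` it reproduces the landed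
equilibrium rung `partOneAt_equilibrium`.

Proof: invariance of the homogeneous law under every flow (`measurePreserving_flow_localGibbsMeasure_homogeneous`)
moves the time-`s` expectation to time `0`; there `E|G_N − m| ≤ ε + E(G_N − m)²/(4ε) ≤ ε + Var/(4ε(N+1))`
(`lintegral_sq_expAvg_sub_le`), and `ε = (N+1)^{-1/2}` gives `(1 + Var/4)(N+1)^{-1/2}`.

No new definitions, no named facts; axioms `propext`, `Classical.choice`, `Quot.sound`.
-/

noncomputable section

open MeasureTheory ProbabilityTheory Filter Set Topology
open scoped ENNReal

namespace Summit.AtomisticToContinuum.HydrodynamicLimit.Theorems.AdiabatCeiling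

open Literature.MathematicalPhysics.KineticTheory Literature.Analysis.FluidPDE

/-- **`stub_partOneFixed` AT HOMOGENEOUS DATA, for every flow.**  At the profiles `(1, θ₀, 0)`, `θ₀ > 0`: for all
`0 < σ < 1/2`, every family of hard-sphere flows, every `t > 0` (the rest of the crux prefix being idle), the empirical
exponential moment at `λ = 1/(8θ₀)` satisfies the fixed-time L¹ law of large numbers
`E_{P_N}|(N+1)⁻¹∑ᵢ e^{λ|vᵢ(s)|²} − m| ≤ (1 + Var/4)(N+1)^{-1/2}` for every `N` and every `s`
(`m`, `Var` = mean and variance of `e^{λ|v|²}` under `N(0, θ₀)`). -/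
theorem partOneFixed_homogeneous :
    ∀ θ₀ : ℝ, 0 < θ₀ →
      ∃ σ₀ : ℝ, 0 < σ₀ ∧ ∃ η₁ : ℝ, 0 < η₁ ∧ ∀ σ : ℝ, 0 < σ → σ < σ₀ →
        ∀ (T : ℝ) (ρ θ : ℝ → T3 → ℝ) (u : ℝ → T3 → V3), IsHardSphereEulerSolution σ T ρ u θ →
        ∀ Φ : (N : ℕ) → HardSphereFlow (Torus.geometry (Fin 3)) (hsDiameter σ N) (N + 1),
          TendstoHydroFieldsAt
              (fun N => localGibbsLaw σ (fun _ => 1) (fun _ => 0) (fun _ => θ₀) N (Φ N)) Φ ρ u θ 0 →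
          ∀ t : ℝ, 0 < t → t < T → (∀ s ∈ Icc 0 t, ∀ x, 2 * ρ s x * σ ^ 3 < η₁) →
            ∃ lam C₁ : ℝ, 0 < lam ∧ ∃ g : ℝ → ℝ, Measurable g ∧ (∀ s ∈ Icc 0 t, |g s| ≤ C₁) ∧
              ∃ δ : ℕ → ℝ, Tendsto δ atTop (𝓝 0) ∧
                ∀ (N : ℕ), ∀ s ∈ Icc 0 t,
                  ∫⁻ z, ENNReal.ofReal
                      |(∫ y, Real.exp (lam * ‖y.2‖ ^ 2) ∂(empiricalMeasure ((Φ N).flow s z))) - g s|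
                    ∂(localGibbsLaw σ (fun _ => 1) (fun _ => 0) (fun _ => θ₀) N (Φ N)) ≤
                  ENNReal.ofReal (δ N) := by
  intro θ₀ hθ
  refine ⟨1 / 2, one_half_pos, 1, one_pos, fun σ _hσ hσlt _T _ρ _θ _u _ Φ _ t _ht _ _ => ?_⟩
  have hσ2 : σ ≤ 1 / 2 := hσlt.le
  -- the witnesses
  set lam : ℝ := 1 / (8 * θ₀) with hlamdef
  have hlam0 : 0 < lam := by positivity
  have hlam : lam < 1 / (4 * θ₀) := by
    rw [hlamdef, div_lt_div_iff_of_pos_left one_pos (by positivity) (by positivity)]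
    linarith
  set γ : Measure V3 := gaussMeasure (0 : V3) θ₀ with hγ
  set m : ℝ := ∫ v, Real.exp (lam * ‖v‖ ^ 2) ∂γ with hm
  set B : ℝ := Var[fun v : V3 => Real.exp (lam * ‖v‖ ^ 2); γ] with hB
  have hB0 : 0 ≤ B := variance_nonneg _ _
  set ε : ℕ → ℝ := fun N => (((N + 1 : ℕ) : ℝ)) ^ (-(1 / 2 : ℝ)) with hεdef
  have hεpos : ∀ N, 0 < ε N := fun N => Real.rpow_pos_of_pos (by positivity) _
  refine ⟨lam, |m|, hlam0, fun _ => m, measurable_const, fun _ _ => le_rfl,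
    fun N => (1 + B / 4) * ε N, ?_, ?_⟩
  · -- the rate tends to zero
    have hε : Tendsto ε atTop (𝓝 0) := by
      have h1 : Tendsto (fun N : ℕ => ((N + 1 : ℕ) : ℝ)) atTop atTop :=
        (tendsto_natCast_atTop_atTop (R := ℝ)).comp (tendsto_add_atTop_nat 1)
      exact (tendsto_rpow_neg_atTop (by norm_num : (0 : ℝ) < 1 / 2)).comp h1
    have h := hε.const_mul (1 + B / 4)
    rwa [mul_zero] at h
  -- the bound at every `N`, `s`
  intro N s _hs
  rw [localGibbsLaw_eq]
  set P : Measure (Config (N + 1) (Fin 3) T3) :=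
    localGibbsMeasure σ (fun _ => 1) (fun _ => 0) (fun _ => θ₀) N with hP
  haveI : IsProbabilityMeasure P :=
    isProbabilityMeasure_localGibbsMeasure (u₀ := fun _ => (0 : V3)) continuous_const continuous_const
      continuous_const (fun _ => one_pos) (fun _ => hθ) hσ2 N
  set G : Config (N + 1) (Fin 3) T3 → ℝ :=
    fun z => ((N + 1 : ℕ) : ℝ)⁻¹ * ∑ i, Real.exp (lam * ‖(z i).2‖ ^ 2) with hG
  have hGm : Measurable G :=
    measurable_const.mul (Finset.measurable_sum _ fun i _ =>
      (measurable_pi_apply i).snd.norm.pow_const 2 |>.const_mul lam |>.exp)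
  have hGemp : ∀ w : Config (N + 1) (Fin 3) T3,
      ∫ y, Real.exp (lam * ‖y.2‖ ^ 2) ∂(empiricalMeasure w) = G w := fun w => by
    simp only [hG, integral_empiricalMeasure]
  have hHm : Measurable fun z => ENNReal.ofReal |G z - m| := (hGm.sub_const m).abs.ennreal_ofReal
  -- invariance moves time `s` to time `0`
  have hinv := measurePreserving_flow_localGibbsMeasure_homogeneous σ θ₀ N (Φ N) s
  have hmove : ∫⁻ z, ENNReal.ofReal |G ((Φ N).flow s z) - m| ∂P = ∫⁻ z, ENNReal.ofReal |G z - m| ∂P :=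
    hinv.lintegral_comp hHm
  simp_rw [hGemp]
  rw [hmove]
  -- the static bound `E|G - m| ≤ ε + Var/(4ε(N+1)) = (1 + Var/4) ε`
  have hsq := lintegral_sq_expAvg_sub_le hσ2 hθ hlam N
  have hεN := hεpos N
  calc ∫⁻ z, ENNReal.ofReal |G z - m| ∂P
      ≤ ∫⁻ z, (ENNReal.ofReal (ε N) + ENNReal.ofReal (1 / (4 * ε N)) * ENNReal.ofReal ((G z - m) ^ 2)) ∂P := by
        refine lintegral_mono fun z => ?_
        rw [← ENNReal.ofReal_mul (by positivity), ← ENNReal.ofReal_add (hεN.le) (by positivity)]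
        refine ENNReal.ofReal_le_ofReal ?_
        calc |G z - m| ≤ ε N + (G z - m) ^ 2 / (4 * ε N) := abs_le_add_sq_div hεN
          _ = ε N + 1 / (4 * ε N) * (G z - m) ^ 2 := by ring
    _ = ENNReal.ofReal (ε N) + ENNReal.ofReal (1 / (4 * ε N)) * ∫⁻ z, ENNReal.ofReal ((G z - m) ^ 2) ∂P := by
        rw [lintegral_add_left measurable_const, lintegral_const, measure_univ, mul_one,
          lintegral_const_mul (ENNReal.ofReal (1 / (4 * ε N)))
            (f := fun z => ENNReal.ofReal ((G z - m) ^ 2)) ((hGm.sub_const m).pow_const 2).ennreal_ofReal]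
    _ ≤ ENNReal.ofReal (ε N) + ENNReal.ofReal (1 / (4 * ε N)) * ENNReal.ofReal (B / ((N + 1 : ℕ) : ℝ)) :=
        add_le_add le_rfl (mul_le_mul' le_rfl hsq)
    _ = ENNReal.ofReal ((1 + B / 4) * ε N) := by
        rw [← ENNReal.ofReal_mul (by positivity), ← ENNReal.ofReal_add hεN.le (by positivity)]
        congr 1
        -- `ε (N+1) = (N+1)^{1/2} = 1/ε`
        have hn : (0 : ℝ) < ((N + 1 : ℕ) : ℝ) := by positivity
        have hroot : ε N * ε N * ((N + 1 : ℕ) : ℝ) = 1 := by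
          rw [hεdef]
          dsimp only
          rw [← Real.rpow_add hn, ← Real.rpow_add_one hn.ne']
          norm_num
        field_simp
        nlinarith [hroot, hεN]

end Summit.AtomisticToContinuum.HydrodynamicLimit.Theorems.AdiabatCeiling
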